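import Mathlib
import HarnessLib
import HarnessLib.Audit
import Summits.AtomisticToContinuum.Statement
import Literature.MathematicalPhysics.QuantumManyBody.PeriodicBoseGas
import Literature.MathematicalPhysics.QuantumManyBody.PeriodicBoseGasFourier

/-!
Route: BECHusimiLaplace

CLOSED (retired) 2026-08-15T13:38:47Z by operator:999:1257524 — reason: not-a-thesis: assembly does not conclude the sub-problem Statement — note: D-0027 §2.1 audit (human 2026-08-15: routes that do not decide the summit are removed): the assembly concludes `Literature.MathematicalPhysics.QuantumManyBody.BoseGas.BoseEinsteinCondensation`, not the sub-problem statement; a NEW conforming route may be opened from the same idea (generated `closes . The file is kept as the record of this route; refuted decls are indexed as negative knowledge (`ledger negatives`).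

# Route BECHusimiLaplace — BEC as a Laplace principle for the ground state's Husimi measure on the
slow modes

It suffices to show X = HusimiConcentration ∧ TiltStability for NONNEGATIVE periodic near-minimisers
Ψ of the N-body energy on the torus of
side L = (N/ρ)^(1/3) at small ρ (card husimi-laplace-amplitude-gas, spine). Fix the (2R+1)³ plane
waves e_i with |n_k| ≤ R := ⌊M·L·√(ρa)⌋
(cutoff K ≍ M/ξ), Gaussian coefficients c with weight w(c) = e^(−|c|²), u_c = Σ_i c_i e_i, and the
degree-N form F(g) := ∫_(Λ^N) Π_j conj g(x_j) Ψ(X) dX.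
By the exact lower-symbol (Chiribella) identity in Gaussian form, HR(Ψ) := E_w[|⟨u_c,φ₀⟩|²|F(u_c)|²]
/ E_w[|F(u_c)|²] = 1 + n₀(Φ)/‖Φ‖², Φ = P^(⊗N)Ψ the
component with all N particles slow — every normalisation (π^d, N!, dim Sym^N) cancels in the ratio.
HusimiConcentration: HR ≥ 1 + N/2 (the Husimi
measure of Ψ on the slow-mode sphere, dimension d = θN with θ ≍ 8M³√(ρa³), concentrates at the
constant mode: a Laplace principle, sphere entropy
h(θ) against the amplitude-gas free energy). TiltStability: HR − 1 ≤ n₀(Ψ) + C·n_fast(Ψ)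
(conditioning on "no fast particle" raises the condensate
by at most C fast particles). With FastFractionBound (n_fast ≤ ηN from the leading-order energy,
provable) they give n₀ ≥ N/4 for nonnegative
near-minimisers, whence PeriodicBEC (PositivityReduction) and the Dirichlet conjunct
(BoundaryTransferWeak, shared item of BECPeriodicReduction).
Lean: `(∀ v : ℝ → ENNReal,
Literature.MathematicalPhysics.QuantumManyBody.BoseGas.IsRepulsiveFiniteRange v → ∀ M : ℝ, 1 ≤ M → ∃
ρ₀ : ℝ, 0 < ρ₀ ∧ ∀ ρ : ℝ, 0 < ρ → ρ < ρ₀ → ∀ᶠ N : ℕ in Filter.atTop, ∃ δ : ENNReal, 0 < δ ∧ ∀ Ψ :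
Literature.MathematicalPhysics.QuantumManyBody.BoseGas.PeriodicTrialState N
(Literature.MathematicalPhysics.QuantumManyBody.BoseGas.sideLength ρ N),
Literature.MathematicalPhysics.QuantumManyBody.BoseGas.periodicEnergy v Ψ ≤
Literature.MathematicalPhysics.QuantumManyBody.BoseGas.periodicGroundStateEnergy v N
(Literature.MathematicalPhysics.QuantumManyBody.BoseGas.sideLength ρ N) + δ → (∀ X, Ψ.ψ X = ((‖Ψ.ψ
X‖ : ℝ) : ℂ)) → let L : ℝ := Literature.MathematicalPhysics.QuantumManyBody.BoseGas.sideLength ρ N;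
let R : ℕ := ⌊M * L * Real.sqrt (ρ *
(Literature.MathematicalPhysics.QuantumManyBody.BoseGas.scatteringLength v).toReal)⌋₊; let e : (Fin
3 → Fin (2 * R + 1)) → Literature.MathematicalPhysics.QuantumManyBody.BoseGas.Space → ℂ := fun i x
=> Literature.MathematicalPhysics.QuantumManyBody.BoseGas.cellWave L (fun k => ((i k : ℕ) : ℤ) - (R
: ℤ)) x / (Real.sqrt (L ^ 3) : ℂ); let u : ((Fin 3 → Fin (2 * R + 1)) → ℂ) →
Literature.MathematicalPhysics.QuantumManyBody.BoseGas.Space → ℂ := fun c x => ∑ i, c i * e i x; let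
F : (Literature.MathematicalPhysics.QuantumManyBody.BoseGas.Space → ℂ) → ℂ := fun g => ∫ X in
Literature.MathematicalPhysics.QuantumManyBody.BoseGas.cellN N L, (∏ j, conj (g (X j))) * Ψ.ψ X; let
ov : (Literature.MathematicalPhysics.QuantumManyBody.BoseGas.Space → ℂ) → ℂ := fun g => ∫ x in
Literature.MathematicalPhysics.QuantumManyBody.BoseGas.cell L, conj (g x) *
Literature.MathematicalPhysics.QuantumManyBody.BoseGas.constantMode L x; let w : ((Fin 3 → Fin (2 *
R + 1)) → ℂ) → ENNReal := fun c => ENNReal.ofReal (Real.exp (-(∑ i, ‖c i‖ ^ 2))); (∫⁻ c : (Fin 3 →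
Fin (2 * R + 1)) → ℂ, w c * ((‖F (u c)‖₊ : ENNReal) ^ 2)) ≠ 0 ∧ (∫⁻ c : (Fin 3 → Fin (2 * R + 1)) →
ℂ, w c * ((‖F (u c)‖₊ : ENNReal) ^ 2)) ≠ ⊤ ∧ ENNReal.ofReal (1 + (N : ℝ) / 2) * (∫⁻ c : (Fin 3 → Fin
(2 * R + 1)) → ℂ, w c * ((‖F (u c)‖₊ : ENNReal) ^ 2)) ≤ (∫⁻ c : (Fin 3 → Fin (2 * R + 1)) → ℂ, w c *
((‖ov (u c)‖₊ : ENNReal) ^ 2) * ((‖F (u c)‖₊ : ENNReal) ^ 2))) ∧ (∀ v : ℝ → ENNReal,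
Literature.MathematicalPhysics.QuantumManyBody.BoseGas.IsRepulsiveFiniteRange v → ∃ C : ℝ, 0 < C ∧ ∀
M : ℝ, 1 ≤ M → ∃ ρ₀ : ℝ, 0 < ρ₀ ∧ ∀ ρ : ℝ, 0 < ρ → ρ < ρ₀ → ∀ᶠ N : ℕ in Filter.atTop, ∃ δ : ENNReal,
0 < δ ∧ ∀ Ψ : Literature.MathematicalPhysics.QuantumManyBody.BoseGas.PeriodicTrialState N
(Literature.MathematicalPhysics.QuantumManyBody.BoseGas.sideLength ρ N),
Literature.MathematicalPhysics.QuantumManyBody.BoseGas.periodicEnergy v Ψ ≤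
Literature.MathematicalPhysics.QuantumManyBody.BoseGas.periodicGroundStateEnergy v N
(Literature.MathematicalPhysics.QuantumManyBody.BoseGas.sideLength ρ N) + δ → (∀ X, Ψ.ψ X = ((‖Ψ.ψ
X‖ : ℝ) : ℂ)) → let L : ℝ := Literature.MathematicalPhysics.QuantumManyBody.BoseGas.sideLength ρ N;
let R : ℕ := ⌊M * L * Real.sqrt (ρ *
(Literature.MathematicalPhysics.QuantumManyBody.BoseGas.scatteringLength v).toReal)⌋₊; let e : (Fin
3 → Fin (2 * R + 1)) → Literature.MathematicalPhysics.QuantumManyBody.BoseGas.Space → ℂ := fun i x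
=> Literature.MathematicalPhysics.QuantumManyBody.BoseGas.cellWave L (fun k => ((i k : ℕ) : ℤ) - (R
: ℤ)) x / (Real.sqrt (L ^ 3) : ℂ); let u : ((Fin 3 → Fin (2 * R + 1)) → ℂ) →
Literature.MathematicalPhysics.QuantumManyBody.BoseGas.Space → ℂ := fun c x => ∑ i, c i * e i x; let
F : (Literature.MathematicalPhysics.QuantumManyBody.BoseGas.Space → ℂ) → ℂ := fun g => ∫ X in
Literature.MathematicalPhysics.QuantumManyBody.BoseGas.cellN N L, (∏ j, conj (g (X j))) * Ψ.ψ X; let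
ov : (Literature.MathematicalPhysics.QuantumManyBody.BoseGas.Space → ℂ) → ℂ := fun g => ∫ x in
Literature.MathematicalPhysics.QuantumManyBody.BoseGas.cell L, conj (g x) *
Literature.MathematicalPhysics.QuantumManyBody.BoseGas.constantMode L x; let w : ((Fin 3 → Fin (2 *
R + 1)) → ℂ) → ENNReal := fun c => ENNReal.ofReal (Real.exp (-(∑ i, ‖c i‖ ^ 2))); (∫⁻ c : (Fin 3 →
Fin (2 * R + 1)) → ℂ, w c * ((‖ov (u c)‖₊ : ENNReal) ^ 2) * ((‖F (u c)‖₊ : ENNReal) ^ 2)) ≤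
(Literature.MathematicalPhysics.QuantumManyBody.BoseGas.condensateOccupation N L Ψ.ψ +
ENNReal.ofReal C * ((N : ENNReal) - ∑ i,
Literature.MathematicalPhysics.QuantumManyBody.BoseGas.cellOccupation N L (e i) Ψ.ψ) + 1) * (∫⁻ c :
(Fin 3 → Fin (2 * R + 1)) → ℂ, w c * ((‖F (u c)‖₊ : ENNReal) ^ 2)))`

## Assembly
Pure logic (theorem assembly_holds in the planner's Sketch.lean, rc 0): HusimiConcentration :=
LaplaceCapUnion PhaseCapDecay AmplitudeLDP;
PeriodicBECNonneg := RatioToCondensate HusimiConcentration TiltStability FastFractionBound;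
PeriodicBEC := PositivityReduction PeriodicBECNonneg;
then for each v, BoundaryTransferWeak v hv (PeriodicBEC v hv) is HasGroundStateBEC at all small ρ,
i.e. the conjunct. The standard reductions used
inside the supports: Chiribella's lower-symbol formula in Wick/Gaussian form, Plancherel on the
torus, LSSY Thm 2.2 (in tree), ground-state
uniqueness/positivity.

Rationale: WHY THIS LINE. The one-particle density matrix of an N-boson state is read off EXACTLY from its
lower symbol on a d-dimensional one-particle space
(Chiribella2011; ChristandlEtAl2007; Rougerie2014 Thm 4.3; LewinNamRougerie2014deFinetti) — a
representation abandoned in the thermodynamic limit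
because it "loses d/N"; the card's observation is that, cutting at the healing momentum, d/N ≍
8M³√(ρa³) IS Bogoliubov's small parameter, so at
T = 0 in d = 3 the Husimi measure can concentrate, and positivity of the ground state (|F(u)| ≤
F(|u|)) turns the far sphere into large-deviation
UPPER bounds for Lieb's amplitude gas ν = Ψ/∫Ψ (Lieb1963; CarlenJauslinLieb2020) while rough phases
are controlled by anti-concentration of linear
statistics of ν (LebleSerfaty2017-type CLTs), the infrared being decided by Σ_k 1/S_ν(k) < ∞, i.e.
by dimension three. Imported areas: quantum
information (finite de Finetti / lower symbols), Gaussian (Bargmann–Segal) integration, large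
deviations and concentration for Gibbs point
processes. Planner's additions over the card: (i) the Gaussian-ratio typing, which makes the
identity normalisation-free and the cruxes one-line
Props over PeriodicBoseGas; (ii) the proof that the card's sector step B1 must be e^(o(N))-LOSSLESS
— Goldstone softness S_ν(k₁) ≍ ξ/L makes the
rough-phase cap only exp(−cN^(2/3))-small, so any sector bookkeeping costing e^(εN) (dropping P^⊥,
inclusion–exclusion, heat damping) is fatal —
whence B1 is replaced by the conditioning statement TiltStability; (iii) exactness of the identity
supplies the normalisation of the Husimi measure,
so no LDP lower bound is needed on the amplitude side (AmplitudeLDP is stated against the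
pure-condensate reference, which E_w|F|² dominates
identically). No existing route of this sub represents γ_Ψ through a measure on one-particle modes
(34 Theses files grepped: coherent states
appear only in BECRenormGroup's functional integral and BECConditionalEntropy's de Finetti MI
bounds); prior art uses lower symbols for the zero
mode's PRESSURE (LiebSeiringerYngvason2005; Seiringer2008 §2.3) or in mean-field scalings
(LewinNamRougerie2014, LewinNamRougerie2015).

RANKED CRUXES. #2 PhaseCapDecay (crux) — (card B3, the infrared heart) for every admissible v and
every cutoff multiplier M ≥ 1 there is ρ₀(v,M) > 0 such that for 0 < ρ < ρ₀, all large N, some δ > 0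
and every NONNEGATIVE periodic δ-near-minimiser Ψ on the torus of side L = (N/ρ)^(1/3): with modes
|n_k| ≤ R = ⌊M L √(ρa)⌋, Gaussian coefficients c, u_c = Σ c_i e_i and F(g) = ∫ Π_j conj g(x_j) Ψ,
the Husimi mass of the ROUGH-PHASE cap (|⟨u_c,φ₀⟩|² ≤ ¾‖u_c‖² but |⟨|u_c|,φ₀⟩|² > ⅞‖u_c‖²: modulus
nearly flat, phase rough) is at most 1/8 of the total, E_w[1_cap |F(u_c)|²] ≤ (1/8)·E_w[|F(u_c)|²].
[difficulty: open-problem] (why it might fail: Goldstone softness: the phase quadrature of mode k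
has Husimi variance ≍1/S_ν(k), S_ν(k₁)≍ξ/L, so the cap is only exp(−cN^(2/3))-small and the bound
needs MGF/anti-concentration of Σ_jα(x_j) under tilted amplitude-gas laws at local-CLT strength,
which nobody has for hyperuniform gases.) [LebleSerfaty2017, arXiv:1609.08088, GhoshLebowitz2017,
Griffin1993, LiebSeiringerYngvason2005]
#3 AmplitudeLDP (crux) — (card B2 with positivity, integrated form) same setting; the Gaussian mass
of the AMPLITUDE-far region (|⟨|u_c|,φ₀⟩|² ≤ ⅞‖u_c‖²), weighted by the positive functional F(|u_c|)²
= (∫Ψ)²·E_ν[Π_j|u_c(x_j)|]² of Lieb's amplitude gas ν = Ψ/∫Ψ, is at most 1/8 of the pure-condensate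
reference E_w[|⟨u_c,φ₀⟩|^(2N)]·|⟨φ₀^(⊗N),Ψ⟩|²; equivalently non-flat one-body amplitude tilts of ν
cost an exponential rate exceeding the sphere entropy h(θ) = (1+θ)log(1+θ) − θ log θ, θ = (2R+1)³/N
≍ 8M³√(ρa³). [difficulty: open-problem] (why it might fail: needs UPPER bounds on exponential
moments E_ν exp Σ_jφ(x_j), uniform in L, for ALL profiles |u_c| incl. strongly peaked ones
(self-trapping of the Hartree orbital into lumps) with rate > h(θ) ≈ θ log(1/θ); no concentration
inequality for the amplitude gas of the true ground state exists.) [Lieb1963, CarlenJauslinLieb2020,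
CarlenJauslinLieb2021, LewinNamRougerie2015, FriedlandKemp2018]
#4 TiltStability (crux) — (replaces the card's sector decoupling B1) there is C = C(v) such that for
M ≥ 1, ρ < ρ₀(v,M), N large, δ small and every nonnegative periodic near-minimiser Ψ:
E_w[|⟨u_c,φ₀⟩|²|F(u_c)|²] ≤ (n₀(Ψ) + C·n_fast(Ψ) + 1)·E_w[|F(u_c)|²], where n₀ =
condensateOccupation and n_fast = N − Σ_(cube modes) ⟨e_i, γ_Ψ e_i⟩; by the exact Gaussian
lower-symbol identity the left side is (1 + n₀(Φ)/‖Φ‖²)·E_w|F|² with Φ = P^(⊗N)Ψ, so the statement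
says: conditioning Ψ on "all N particles slow" raises the constant-mode occupation by at most C
times the expected number of fast particles (Bogoliubov slaving of UV pairs to the condensate gives
C ≈ 1). [difficulty: L] (why it might fail: conditioning on 'all slow' is a large deviation
(probability ≈exp(−c√(ρa³)N/M)); if UV pairs and condensate correlate beyond Bogoliubov slaving
(three-body/beyond-LHY structure) the conditional n₀ can move by ≫ E n_fast; no e^(εN)-lossy
substitute is admissible (Goldstone caps are subexponential).) [BoccatoEtAl2019,
FournaisSolovej2020, Rougerie2014, Chiribella2011, Seiringer2008]
#5 BoundaryTransferWeak (crux) — (shared verbatim with BECPeriodicReduction,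
stmt-AtomisticToContinuum-0827) for each repulsive finite-range v, constant-mode BEC of periodic
near-minimisers at all small ρ implies the conjunct's Dirichlet, mode-free criterion
HasGroundStateBEC v ρ for all small ρ. [difficulty: L] (why it might fail: PeriodicBEC(v) is
ground-state-only (δ after N): the Dirichlet ground state lies a wall term ≫δ above E₀^per and
interior restrictions are neither periodic nor of sharp N, so the hypothesis may never fire; BEC is
boundary-condition sensitive (Robinson1976).) [LiebSeiringerSolovejYngvason2005, Basti2022,
BoccatoSeiringer2023, Junge2026, LauwersVerbeureZagrebnov2003]
#9 FastFractionBound (support) — for admissible v and η > 0 there is M₀ such that for M ≥ M₀, ρ <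
ρ₀(v,M,η), N large, δ small, every periodic δ-near-minimiser has at most ηN particles outside the
cube of modes |n_k| ≤ R = ⌊M L √(ρa)⌋: N − Σ_i ⟨e_i,γ_Ψ e_i⟩ ≤ ηN. Proof route: Plancherel on the
torus (tsum_sq_grad_cellFourierCoeff) gives (2π(R+1)/L)²·n_fast ≤ kinetic ≤ periodicEnergy ≤ E₀^per
+ δ ≤ 4πaρ₁N(1 + C a/b) + δ by LSSY2005_upperBound_periodic_holds (in tree), so n_fast ≤
(1+o(1))N/(πM²); a = 0 handled by δ < 4π²ηN/L². [difficulty: provable-now]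
[LiebSeiringerSolovejYngvason2005, Fournais2020]
#9 HusimiConcentration (support) — (the Laplace-principle node; = LaplaceCapUnion(PhaseCapDecay,
AmplitudeLDP), also attackable directly) for admissible v and M ≥ 1 there is ρ₀(v,M) such that for ρ
< ρ₀, N large, δ small and every nonnegative periodic near-minimiser: 0 < E_w[|F(u_c)|²] < ∞ and
E_w[|⟨u_c,φ₀⟩|²|F(u_c)|²] ≥ (1 + N/2)·E_w[|F(u_c)|²] — the conditioned state P^(⊗N)Ψ/‖P^(⊗N)Ψ‖ has
constant-mode occupation ≥ N/2. [difficulty: open-problem] [Rougerie2014, Chiribella2011,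
LewinNamRougerie2015]
#9 LaplaceCapUnion (support) — PhaseCapDecay → AmplitudeLDP → HusimiConcentration. Bookkeeping of
the Laplace principle: far cap (t := |⟨u,φ₀⟩|²/‖u‖² ≤ ¾) ⊆ rough-phase cap ∪ amplitude-far region;
on the latter |F(u_c)| ≤ F(|u_c|) (Ψ ≥ 0) and E_w|F(u_c)|² ≥ E_w[|⟨u_c,φ₀⟩|^(2N)]·|⟨φ₀^(⊗N),Ψ⟩|²
(the c̄₀^N coefficient of the polynomial F(u_c), Gaussian orthogonality of monomials), so the far
cap has Husimi mass ≤ ¼; then E_w[|⟨u_c,φ₀⟩|²|F|²] ≥ ¾·E_w[1_near ‖u_c‖²|F|²] = ¾(N+d)·E_w[1_near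
|F|²] ≥ (9/16)(N+d)E_w|F|² ≥ (1+N/2)E_w|F|² for N ≥ 7 (radial integration / Euler identity for the
bidegree-(N,N) form; finiteness and non-vanishing of E_w|F|² from |F(u_c)| ≤ ‖u_c‖^N and ∫Ψ > 0).
[glue] [difficulty: provable-now] [Rougerie2014, Chiribella2011]
#9 PeriodicBECNonneg (support) — constant-mode BEC for NONNEGATIVE periodic near-minimisers: for
every admissible v there is ρ₀ > 0 such that for 0 < ρ < ρ₀ there is c > 0 with: for all large N
some δ > 0 makes every periodic δ-near-minimiser Ψ with Ψ ≥ 0 pointwise satisfy condensateOccupation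
≥ cN (the node where the Husimi cruxes land; = RatioToCondensate(HusimiConcentration, TiltStability,
FastFractionBound) with c = 1/4). [difficulty: open-problem] [LiebSeiringerSolovejYngvason2005,
Fournais2020]
#9 RatioToCondensate (support) — HusimiConcentration → TiltStability → FastFractionBound →
PeriodicBECNonneg: with C from TiltStability take η = 1/(4C), M = max(1, M₀(η)), ρ₀ = min of the
three, δ = min of the three; then (1+N/2)·D ≤ Num ≤ (n₀ + C·ηN + 1)·D with 0 < D < ∞ gives n₀ ≥ N/4
(ENNReal algebra, filter bookkeeping). [glue] [difficulty: provable-now]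
[LiebSeiringerSolovejYngvason2005]
#9 PositivityReduction (support) — PeriodicBECNonneg → PeriodicBEC (body of
stmt-AtomisticToContinuum-0826 verbatim): at fixed N and L, as δ → 0 near-minimisers converge in L²
(compact resolvent) to the ground space; for v finite a.e. the periodic ground state is unique and
positive (positivity-improving heat kernel, Reed–Simon XIII.12/47), nonnegative C¹ near-minimisers
exist by periodic mollification, and Ψ ↦ ⟨φ₀,γ_Ψφ₀⟩ is L²-Lipschitz (|√n₀(Ψ) − √n₀(Φ)| ≤ √N‖Ψ −
θΦ‖), so c/2 transfers; hard cores (v = ⊤ on [0,a]) need connectedness of the low-density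
hard-sphere configuration space for uniqueness and core-respecting approximants — the one caveat.
[difficulty: M] [LiebSeiringerSolovejYngvason2005, PenroseOnsager1956]

TWO-LAYER PLAN. Foreseen glued splits (k ≤ 3, depth 1; nothing filed now): PhaseCapDecay ⇐
AmplitudeFloor (S_ν(k) ≥ c′·min(|k|ξ,1) for 2π/L ≤ |k| ≤ K,
uniformly in L — the anti-hyperuniformity floor of the amplitude gas) → PhaseMGFDomination (the
rough-phase content Σ_k q_k² of the Husimi measure
is MGF-dominated by ⊗_k CN(0, C/S_ν(k)), giving cap mass ≤ exp(−cNS_min + Σ_k S_min/S_ν(k))) →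
PhaseCapDecay. AmplitudeLDP ⇐ FlatIsOptimal
(⟨g^(⊗N),Ψ⟩ ≤ e^(o(N))⟨φ₀^(⊗N),Ψ⟩ on the positive unit cone) → LocalAmplitudeConvexity (rate ≥ κ·(1
− ⟨ĝ,φ₀⟩²) with κ > 8h(θ)) → AmplitudeLDP.
TiltStability ⇐ PairSlaving (law of the slow sector conditioned on no fast particle vs
unconditioned, compared in n₀ up to C·E n_fast) →
TiltStability; reserve variant: heat-kernel covariance e^(τΔ) instead of the sharp cube (soft UV
tilt e^(−τT̂)).

KILL CRITERIA. A proof that for some admissible v at arbitrarily small ρ the rough-phase cap keeps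
Husimi mass ≥ 1/8 for nonnegative near-minimisers
(¬PhaseCapDecay; e.g. via an amplitude gas with Σ_k 1/S_ν(k) ≫ N, S_ν(k) ≲ k³) closes the route
`refuted:PhaseCapDecay` — the Laplace picture then
predicts no Husimi concentration at any cutoff. ¬AmplitudeLDP (lumps of the amplitude gas at rate
below h(θ) for every M) closes it likewise.
¬TiltStability forces ONE pivot (restate with the soft heat-kernel tilt, same decl); refuted again →
close. ¬HusimiConcentration with BEC
unrefuted means the conditioned state P^(⊗N)Ψ₀ depletes while Ψ₀ condenses — kills the
representation, close. ¬PeriodicBEC (stmt-0826) kills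
every torus route incl. this one; ¬BoundaryTransferWeak kills the assembly but not the Husimi line
(re-assemble through a Dirichlet variant).
PeriodicBEC proved by any other route makes ranks 2–4 moot for the conjunct (route superseded) but
leaves HusimiConcentration as a structural
statement.

NOT DECOMPOSED YET. The constants ¾, ⅞, ⅛, ½, ¼ (chosen so that the glue is exact arithmetic; a
refuter-forced retune is a 1:1 restate); the floor/MGF children of
PhaseCapDecay and the convexity children of AmplitudeLDP (layer 2, above); the prediction S_ν = 2S_μ
(Gaussianity of the macroscopic density
field — a falsifiable by-product, not load-bearing); cube versus ball of modes; the hard-core caveat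
of PositivityReduction; any use of the
companion card diffuse-counting-impostor-census (polynomial anti-concentration from the
eigen-equation) as input to PhaseCapDecay.

CHEAPEST FALSIFIER. Compute everything for the explicit Bogoliubov/Jastrow trial state (LSSY Thm
2.2's Dyson–Jastrow Ψ = ΠF(t_i) or the number-projected quasi-free
pair state) at ρa³ = 10⁻⁴, M = 1: all four Husimi functionals are Gaussian/cluster integrals there.
If the rough-phase cap of THAT state already
carries > 1/8 of the Husimi mass (i.e. (1/N)Σ_(|k|≤K) 1/S_ν(k) is not ≪ ¾ at these parameters), the
constants must be retuned, and if no constants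
work the line is dead before touching Ψ₀. Second: the card's flat-trial PIGS test S_ν(k)/S_μ(k) → 2
and the floor S_ν ≥ c′kξ (a kit job; NOT run
by the planner — hub compute-free, no job submitted). Third (lookup, done: nothing found): a printed
concentration inequality for linear
statistics of the Bose ground-state amplitude gas would make AmplitudeLDP `known`.

NUMBERS. θ = d/N = (2R+1)³/N ≈ 8M³√(ρa³) (R = ⌊ML√(ρa)⌋, L³ = N/ρ); sphere entropy h(θ) ≈ θ
log(1/θ), and h(θ) < log(8/7) = 0.1335 ⇔ θ < 0.029 ⇔
√(ρa³) < 3.6·10⁻³/M³ (the pure-condensate benchmark of AmplitudeLDP: cap weight ≤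
8(7/8)^N·C(N+d−1,N)). Fast fraction: n_fast/N ≤ (1+o(1))/(πM²)
from kinetic ≤ 4πaρN(1 + C a/b) (LiebSeiringerSolovejYngvason2005 Thm 2.2 (2.14), in tree:
LSSY2005_upperBound_periodic_holds) and
K_min = 2πM√(ρa); Bogoliubov values for orientation: depletion (8/(3√π))√(ρa³) = 1.505√(ρa³), fast
particles above K ≍ M/ξ ≈ 6√(ρa³)N/M (Tan
tail), top-sector probability ≈ exp(−c√(ρa³)N/M). Infrared sum under the floor S_ν ≥ c′kξ:
(1/N)Σ_(0<|k|≤K) 1/S_ν(k) ≈ 6.4M²√(ρa³)/c′; softest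
mode S_ν(k₁) ≍ ξ·2π/L ∝ N^(−1/3), so the rough-phase cap is ≈exp(−c·N^(2/3)) — subexponential (the
reason TiltStability must be lossless). Window:
1 ≪ M ≪ (ρa³)^(−1/6). Items at open: 11 (4 cruxes, 6 support/glue, 1 assembly).

DEFINITION REQUESTS. None: every functional is inlined by `let` over PeriodicBoseGas /
PeriodicBoseGasFourier vocabulary (cellWave, cell, cellN, constantMode,
condensateOccupation, cellOccupation, scatteringLength, sideLength); a later convenience definition
`husimiRatio` in
Literature/MathematicalPhysics/QuantumManyBody would shorten the signatures but is not needed to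
staff the cruxes. Bib entries for Chiribella2011,
ChristandlEtAl2007, Rougerie2014, LewinNamRougerie2014deFinetti, LewinNamRougerie2015,
LewinNamRougerie2014, Seiringer2008, FriedlandKemp2018
submitted with this route (ledger bib add).

Novelty: Searches (2026-08-15): `lit search --hybrid "quantum de Finetti Husimi measure lower symbol
one-particle density matrix bosons condensate"` (12 held
textbooks; nearest BenedikterPortaSchlein2016 pp.38,50, LSSY2005 p.116); `lit galaxy search "quantum
de Finetti" --star all` (30 rows: LNR
hal-01070599 = LewinNamRougerie2015, Dimonte–Falconi–Olgiati arXiv:1809.03586, Chiribella's thesis;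
no thermodynamic-limit use);
`lit galaxy search "quantum de Finetti theorem bosons Husimi" --star all` (0); `lit search --source
zbmath "de Finetti bosons"` (10: Rougerie2014 =
arXiv:1409.1182, Gottlieb arXiv:quant-ph/0506111, Triay arXiv:1703.03746 — mean-field/GP only);
arXiv / OpenAlex / S2 legs HTTP 429 (recorded);
`lit read arXiv:1409.1182` p.33 Thm 4.3 (Chiribella formula = the identity behind HR); grep of all
34 Theses/*.lean of the sub for
husimi|coherent state|lower symbol|de Finetti|amplitude gas|Laplace (no route with this mechanism);
card's own searches (vsearch, galaxy pdf
"geometric measure of entanglement", frontier) and refuter audit-12 (zbMATH LNR) inherited.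
Nearest prior art found: Chiribella2011 / ChristandlEtAl2007 / Rougerie2014 Thm 4.3 /
LewinNamRougerie2014deFinetti (exact lower-symbol marginal
formula, used with d fixed or dn ≪ N); LewinNamRougerie2015 (doi:10.5802/jep.18: Husimi
energy–entropy variational structure with d → ∞, mean-field,
T > 0); LiebSeiringerYngvason2005 (arXiv:math-ph/0412034) and Seiringer2008 §2.3 (coherent states
for the zero mode / all |p| < p_c i  [refs: 10.5802/jep.18:, 1809.03586, 1409.1182, quant-ph/0506111, 1703.03746, math-ph/0412034, 1612.00578, doi:10.5802/jep.18, LSSY2005, LewinNamRougerie2015, Rougerie2014, Chiribella2011, ChristandlEtAl2007, LiebSeiringerYngvason2005, Seiringer2008, FriedlandKemp2018]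

Barriers (technique_class: coherent-state-Husimi, amplitude-gas-LDP, anti-concentration): - technique_class: coherent-state-Husimi, amplitude-gas-LDP, anti-concentration
- Literature.Barriers.AtomisticToContinuum.KineticGapLengthScales: evaded — no gap or Poincaré step
anywhere; L-uniformity is asked of amplitude-gas large-deviation constants (AmplitudeLDP) and of a
RELATIVE cap mass (PhaseCapDecay); the only energy input is kinetic ≤ total at leading order
(FastFractionBound), which holds at L = (N/ρ)^(1/3).
- Literature.Barriers.AtomisticToContinuum.EnergyAsymptoticsWithoutCondensation: respected —
LHY-precision energy is never converted into depletion; the cruxes are properties of the positive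
near-minimiser itself, and the 1-D Lieb–Liniger witness is reproduced (Σ_k 1/S_ν(k) diverges in d =
1, so PhaseCapDecay is false there, as it must be).
- Literature.Barriers.AtomisticToContinuum.BogoliubovPerturbationInfrared: it does not fully evade
it; PhaseCapDecay IS the infrared problem (Goldstone phase modes, local-CLT strength) — the bet is
that MGF/anti-concentration bounds for linear statistics of a POSITIVE translation-invariant measure
are more accessible than resumming Beliaev–Gavoret–Nozières diagrams, and the marginal logs of
(3+1)-D enter only through the convergent sum Σ_k 1/S_ν(k).
- Literature.Barriers.AtomisticToContinuum.SymmetryBreakingWithoutCondensate: applies in spirit —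
LSSY (D.19) shows a zero-mode lower-symbol weight may spread (no BEC) while its tilts concentrate,
so the Husimi identity alone excludes nothing; evasion = x-space positivity |F(u)

Novelty grade: new-combination — ROUTE REVIEW (refuter, 2026-08-15; route already CLOSED(retired) 13:38Z by operator D-0027 §2.1 — assembly concluded Literature…BoseGas.BoseEinsteinCondensation instead of the abbrev _root_.BoseEinsteinCondensation; conforming re-filing allowed, this note is for it). VERDICT: precise, non-vacuous, n (refuter refuter-rreview-route-AtomisticToContinu-4a1d4216-0, 2026-08-15T14:03:31Z; prior: Chiribella2011 / ChristandlEtAl2007 / Rougerie2014 Thm 4.3 (arXiv:1409.1182) / LewinNamRougerie2014 (exact lower-symbol marginal formula, d fixed or dn≪N), LewinNamRougerie2015 doi:10.5802/jep.18 (Husimi energy–entropy structure, mean-field T>0), LiebSeiringerYngvason2005 arXiv:math-ph/0412034, Seiringer2008 §2.3 (coherent states for the zero mode / |p|<p_c, pressure only), Lieb1963, CarlenJauslin)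

History (route lifecycle, newest last):
- 2026-08-15T13:38:47Z · CLOSED retired — not-a-thesis: assembly does not conclude the sub-problem Statement (operator:999:1257524)

sub-problem: BoseEinsteinCondensation · status: closed(retired) · opened planner-plancard-AtomisticToContinuum-BoseEin-71d5fa7f-0 2026-08-15T12:32:45Z · rev 0 · ledger route-AtomisticToContinuum-BECHusimiLaplace
GENERATED by the gate from the ledger (D-0016/17). Provers cite these decls: `theorem foo : Summit.AtomisticToContinuum.BoseEinsteinCondensation.Theses.BECHusimiLaplace.<Decl> := …` in Summits/AtomisticToContinuum/BoseEinsteinCondensation/Theorems/<Name>.lean.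
-/

namespace Summit.AtomisticToContinuum.BoseEinsteinCondensation.Theses.BECHusimiLaplace

open scoped BigOperators Topology Manifold Classical MeasureTheory ProbabilityTheory Matrix InnerProductSpace ComplexConjugate ContinuousMap
open Filter Set Function TopologicalSpace MeasureTheory

attribute [summit_statement] _root_.BoseEinsteinCondensation

/-- item stmt-AtomisticToContinuum-8196 · crux · rank 2 · closed · moot by None · by planner
why it might fail: Goldstone softness: the phase quadrature of mode k has Husimi variance ≍1/S_ν(k), S_ν(k₁)≍ξ/L, so the cap is only exp(−cN^(2/3))-small and the bound needs MGF/anti-concentration of Σ_jα(x_j) under tilted amplitude-gas laws at local-CLT strength, which nobody has for hyperuniform gases.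
sources: LebleSerfaty2017, arXiv:1609.08088, GhoshLebowitz2017, Griffin1993, LiebSeiringerYngvason2005
[crux] (card B3, the infrared heart) for every admissible v and every cutoff multiplier M ≥ 1 there
is ρ₀(v,M) > 0 such that for 0 < ρ < ρ₀, all large N, some δ > 0 and every NONNEGATIVE periodic
δ-near-minimiser Ψ on the torus of side L = (N/ρ)^(1/3): with modes |n_k| ≤ R = ⌊M L √(ρa)⌋,
Gaussian coefficients c, u_c = Σ c_i e_i and F(g) = ∫ Π_j conj g(x_j) Ψ, the Husimi mass of the
ROUGH-PHASE cap (|⟨u_c,φ₀⟩|² ≤ ¾‖u_c‖² but |⟨|u_c|,φ₀⟩|² > ⅞‖u_c‖²: modulus nearly flat, phase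
rough) is at most 1/8 of the total, E_w[1_cap |F(u_c)|²] ≤ (1/8)·E_w[|F(u_c)|²]. [difficulty:
open-problem] -/
@[route_item "route-AtomisticToContinuum-BECHusimiLaplace"]
def PhaseCapDecay : Prop :=
  ∀ v : ℝ → ENNReal, Literature.MathematicalPhysics.QuantumManyBody.BoseGas.IsRepulsiveFiniteRange v → ∀ M : ℝ, 1 ≤ M → ∃ ρ₀ : ℝ, 0 < ρ₀ ∧ ∀ ρ : ℝ, 0 < ρ → ρ < ρ₀ → ∀ᶠ N : ℕ in Filter.atTop, ∃ δ : ENNReal, 0 < δ ∧ ∀ Ψ : Literature.MathematicalPhysics.QuantumManyBody.BoseGas.PeriodicTrialState N (Literature.MathematicalPhysics.QuantumManyBody.BoseGas.sideLength ρ N), Literature.MathematicalPhysics.QuantumManyBody.BoseGas.periodicEnergy v Ψ ≤ Literature.MathematicalPhysics.QuantumManyBody.BoseGas.periodicGroundStateEnergy v N (Literature.MathematicalPhysics.QuantumManyBody.BoseGas.sideLength ρ N) + δ → (∀ X, Ψ.ψ X = ((‖Ψ.ψ X‖ : ℝ) : ℂ)) → let L : ℝ := Literature.MathematicalPhysics.QuantumManyBody.BoseGas.sideLength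 ρ N; let R : ℕ := ⌊M * L * Real.sqrt (ρ * (Literature.MathematicalPhysics.QuantumManyBody.BoseGas.scatteringLength v).toReal)⌋₊; let e : (Fin 3 → Fin (2 * R + 1)) → Literature.MathematicalPhysics.QuantumManyBody.BoseGas.Space → ℂ := fun i x => Literature.MathematicalPhysics.QuantumManyBody.BoseGas.cellWave L (fun k => ((i k : ℕ) : ℤ) - (R : ℤ)) x / (Real.sqrt (L ^ 3) : ℂ); let u : ((Fin 3 → Fin (2 * R + 1)) → ℂ) → Literature.MathematicalPhysics.QuantumManyBody.BoseGas.Space → ℂ := fun c x => ∑ i, c i * e i x; let F : (Literature.MathematicalPhysics.QuantumManyBody.BoseGas.Space → ℂ) → ℂ := fun g => ∫ X in Literature.MathematicalPhysics.QuantumManyBody.BoseGas.cellN N L, (∏ j, conj (g (X j))) * Ψ.ψ X; let ov : (Literature.MathematicalPhysics.QuantumManyBody.BoseGas.Space → ℂ) → ℂ := fun g => ∫ x in Literature.MathematicalPhysics.QuantumManyBody.BoseGas.cell L, conj (g x) * Literature.MathematicalPhysics.QuantumManyBody.BoseGas.constantMode L x; let w : ((Fin 3 → Fin (2 * R + 1))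 → ℂ) → ENNReal := fun c => ENNReal.ofReal (Real.exp (-(∑ i, ‖c i‖ ^ 2))); let farPhase : ((Fin 3 → Fin (2 * R + 1)) → ℂ) → Prop := fun c => ‖ov (u c)‖ ^ 2 ≤ (3 / 4) * ∑ i, ‖c i‖ ^ 2 ∧ (7 / 8) * ∑ i, ‖c i‖ ^ 2 < ‖ov (fun x => ((‖u c x‖ : ℝ) : ℂ))‖ ^ 2; (∫⁻ c : (Fin 3 → Fin (2 * R + 1)) → ℂ, w c * (if farPhase c then 1 else 0) * ((‖F (u c)‖₊ : ENNReal) ^ 2)) ≤ (1 / 8) * (∫⁻ c : (Fin 3 → Fin (2 * R + 1)) → ℂ, w c * ((‖F (u c)‖₊ : ENNReal) ^ 2))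

/-- item stmt-AtomisticToContinuum-8197 · crux · rank 3 · closed · moot by None · by planner
why it might fail: needs UPPER bounds on exponential moments E_ν exp Σ_jφ(x_j), uniform in L, for ALL profiles |u_c| incl. strongly peaked ones (self-trapping of the Hartree orbital into lumps) with rate > h(θ) ≈ θ log(1/θ); no concentration inequality for the amplitude gas of the true ground state exists.
sources: Lieb1963, CarlenJauslinLieb2020, CarlenJauslinLieb2021, LewinNamRougerie2015, FriedlandKemp2018
[crux] (card B2 with positivity, integrated form) same setting; the Gaussian mass of the
AMPLITUDE-far region (|⟨|u_c|,φ₀⟩|² ≤ ⅞‖u_c‖²), weighted by the positive functional F(|u_c|)² =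
(∫Ψ)²·E_ν[Π_j|u_c(x_j)|]² of Lieb's amplitude gas ν = Ψ/∫Ψ, is at most 1/8 of the pure-condensate
reference E_w[|⟨u_c,φ₀⟩|^(2N)]·|⟨φ₀^(⊗N),Ψ⟩|²; equivalently non-flat one-body amplitude tilts of ν
cost an exponential rate exceeding the sphere entropy h(θ) = (1+θ)log(1+θ) − θ log θ, θ = (2R+1)³/N
≍ 8M³√(ρa³). [difficulty: open-problem] -/
@[route_item "route-AtomisticToContinuum-BECHusimiLaplace"]
def AmplitudeLDP : Prop :=
  ∀ v : ℝ → ENNReal, Literature.MathematicalPhysics.QuantumManyBody.BoseGas.IsRepulsiveFiniteRange v → ∀ M : ℝ, 1 ≤ M → ∃ ρ₀ : ℝ, 0 < ρ₀ ∧ ∀ ρ : ℝ, 0 < ρ → ρ < ρ₀ → ∀ᶠ N : ℕ in Filter.atTop, ∃ δ : ENNReal, 0 < δ ∧ ∀ Ψ : Literature.MathematicalPhysics.QuantumManyBody.BoseGas.PeriodicTrialState N (Literature.MathematicalPhysics.QuantumManyBody.BoseGas.sideLength ρ N), Literature.MathematicalPhysics.QuantumManyBody.BoseGas.periodicEnergy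 v Ψ ≤ Literature.MathematicalPhysics.QuantumManyBody.BoseGas.periodicGroundStateEnergy v N (Literature.MathematicalPhysics.QuantumManyBody.BoseGas.sideLength ρ N) + δ → (∀ X, Ψ.ψ X = ((‖Ψ.ψ X‖ : ℝ) : ℂ)) → let L : ℝ := Literature.MathematicalPhysics.QuantumManyBody.BoseGas.sideLength ρ N; let R : ℕ := ⌊M * L * Real.sqrt (ρ * (Literature.MathematicalPhysics.QuantumManyBody.BoseGas.scatteringLength v).toReal)⌋₊; let e : (Fin 3 → Fin (2 * R + 1)) → Literature.MathematicalPhysics.QuantumManyBody.BoseGas.Space → ℂ := fun i x => Literature.MathematicalPhysics.QuantumManyBody.BoseGas.cellWave L (fun k => ((i k : ℕ) : ℤ) - (R : ℤ)) x / (Real.sqrt (L ^ 3) : ℂ); let u : ((Fin 3 → Fin (2 * R + 1)) → ℂ) → Literature.MathematicalPhysics.QuantumManyBody.BoseGas.Space → ℂ := fun c x => ∑ i, c i * e i x; let F : (Literature.MathematicalPhysics.QuantumManyBody.BoseGas.Space → ℂ) → ℂ := fun g => ∫ X in Literature.MathematicalPhysics.QuantumManyBody.BoseGas.cellN N L, (∏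 j, conj (g (X j))) * Ψ.ψ X; let ov : (Literature.MathematicalPhysics.QuantumManyBody.BoseGas.Space → ℂ) → ℂ := fun g => ∫ x in Literature.MathematicalPhysics.QuantumManyBody.BoseGas.cell L, conj (g x) * Literature.MathematicalPhysics.QuantumManyBody.BoseGas.constantMode L x; let w : ((Fin 3 → Fin (2 * R + 1)) → ℂ) → ENNReal := fun c => ENNReal.ofReal (Real.exp (-(∑ i, ‖c i‖ ^ 2))); let farAmp : ((Fin 3 → Fin (2 * R + 1)) → ℂ) → Prop := fun c => ‖ov (fun x => ((‖u c x‖ : ℝ) : ℂ))‖ ^ 2 ≤ (7 / 8) * ∑ i, ‖c i‖ ^ 2; (∫⁻ c : (Fin 3 → Fin (2 * R + 1)) → ℂ, w c * (if farAmp c then 1 else 0) * ((‖F (fun x => ((‖u c x‖ : ℝ) : ℂ))‖₊ : ENNReal) ^ 2)) ≤ (1 / 8) * (∫⁻ c : (Fin 3 → Fin (2 * R + 1)) → ℂ, w c * ((‖ov (u c)‖₊ : ENNReal) ^ (2 * N))) * ((‖F (Literature.MathematicalPhysics.QuantumManyBody.BoseGas.constantMode L)‖₊ : ENNReal) ^ 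2)

/-- item stmt-AtomisticToContinuum-8198 · crux · rank 4 · closed · moot by None · by planner
why it might fail: conditioning on 'all slow' is a large deviation (probability ≈exp(−c√(ρa³)N/M)); if UV pairs and condensate correlate beyond Bogoliubov slaving (three-body/beyond-LHY structure) the conditional n₀ can move by ≫ E n_fast; no e^(εN)-lossy substitute is admissible (Goldstone caps are subexponential).
sources: BoccatoEtAl2019, FournaisSolovej2020, Rougerie2014, Chiribella2011, Seiringer2008
[crux] (replaces the card's sector decoupling B1) there is C = C(v) such that for M ≥ 1, ρ <
ρ₀(v,M), N large, δ small and every nonnegative periodic near-minimiser Ψ: E_w[|⟨u_c,φ₀⟩|²|F(u_c)|²]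
≤ (n₀(Ψ) + C·n_fast(Ψ) + 1)·E_w[|F(u_c)|²], where n₀ = condensateOccupation and n_fast = N − Σ_(cube
modes) ⟨e_i, γ_Ψ e_i⟩; by the exact Gaussian lower-symbol identity the left side is (1 +
n₀(Φ)/‖Φ‖²)·E_w|F|² with Φ = P^(⊗N)Ψ, so the statement says: conditioning Ψ on "all N particles
slow" raises the constant-mode occupation by at most C times the expected number of fast particles
(Bogoliubov slaving of UV pairs to the condensate gives C ≈ 1). [difficulty: L] -/
@[route_item "route-AtomisticToContinuum-BECHusimiLaplace"]
def TiltStability : Prop :=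
  ∀ v : ℝ → ENNReal, Literature.MathematicalPhysics.QuantumManyBody.BoseGas.IsRepulsiveFiniteRange v → ∃ C : ℝ, 0 < C ∧ ∀ M : ℝ, 1 ≤ M → ∃ ρ₀ : ℝ, 0 < ρ₀ ∧ ∀ ρ : ℝ, 0 < ρ → ρ < ρ₀ → ∀ᶠ N : ℕ in Filter.atTop, ∃ δ : ENNReal, 0 < δ ∧ ∀ Ψ : Literature.MathematicalPhysics.QuantumManyBody.BoseGas.PeriodicTrialState N (Literature.MathematicalPhysics.QuantumManyBody.BoseGas.sideLength ρ N), Literature.MathematicalPhysics.QuantumManyBody.BoseGas.periodicEnergy v Ψ ≤ Literature.MathematicalPhysics.QuantumManyBody.BoseGas.periodicGroundStateEnergy v N (Literature.MathematicalPhysics.QuantumManyBody.BoseGas.sideLength ρ N) + δ → (∀ X, Ψ.ψ X = ((‖Ψ.ψ X‖ : ℝ) : ℂ)) → let L : ℝ := Literature.MathematicalPhysics.QuantumManyBody.BoseGas.sideLength ρ N; let R : ℕ := ⌊M * L * Real.sqrt (ρ * (Literature.MathematicalPhysics.QuantumManyBody.BoseGas.scatteringLength v).toReal)⌋₊; let e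 : (Fin 3 → Fin (2 * R + 1)) → Literature.MathematicalPhysics.QuantumManyBody.BoseGas.Space → ℂ := fun i x => Literature.MathematicalPhysics.QuantumManyBody.BoseGas.cellWave L (fun k => ((i k : ℕ) : ℤ) - (R : ℤ)) x / (Real.sqrt (L ^ 3) : ℂ); let u : ((Fin 3 → Fin (2 * R + 1)) → ℂ) → Literature.MathematicalPhysics.QuantumManyBody.BoseGas.Space → ℂ := fun c x => ∑ i, c i * e i x; let F : (Literature.MathematicalPhysics.QuantumManyBody.BoseGas.Space → ℂ) → ℂ := fun g => ∫ X in Literature.MathematicalPhysics.QuantumManyBody.BoseGas.cellN N L, (∏ j, conj (g (X j))) * Ψ.ψ X; let ov : (Literature.MathematicalPhysics.QuantumManyBody.BoseGas.Space → ℂ) → ℂ := fun g => ∫ x in Literature.MathematicalPhysics.QuantumManyBody.BoseGas.cell L, conj (g x) * Literature.MathematicalPhysics.QuantumManyBody.BoseGas.constantMode L x; let w : ((Fin 3 → Fin (2 * R + 1)) → ℂ) → ENNReal := fun c => ENNReal.ofReal (Real.exp (-(∑ i, ‖c i‖ ^ 2))); (∫⁻ c : (Fin 3 → Fin (2 * R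 + 1)) → ℂ, w c * ((‖ov (u c)‖₊ : ENNReal) ^ 2) * ((‖F (u c)‖₊ : ENNReal) ^ 2)) ≤ (Literature.MathematicalPhysics.QuantumManyBody.BoseGas.condensateOccupation N L Ψ.ψ + ENNReal.ofReal C * ((N : ENNReal) - ∑ i, Literature.MathematicalPhysics.QuantumManyBody.BoseGas.cellOccupation N L (e i) Ψ.ψ) + 1) * (∫⁻ c : (Fin 3 → Fin (2 * R + 1)) → ℂ, w c * ((‖F (u c)‖₊ : ENNReal) ^ 2))

/-- item stmt-AtomisticToContinuum-8199 · support · rank 9 · closed · moot by None · by planner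
sources: LiebSeiringerSolovejYngvason2005, Fournais2020
[support] for admissible v and η > 0 there is M₀ such that for M ≥ M₀, ρ < ρ₀(v,M,η), N large, δ
small, every periodic δ-near-minimiser has at most ηN particles outside the cube of modes |n_k| ≤ R
= ⌊M L √(ρa)⌋: N − Σ_i ⟨e_i,γ_Ψ e_i⟩ ≤ ηN. Proof route: Plancherel on the torus
(tsum_sq_grad_cellFourierCoeff) gives (2π(R+1)/L)²·n_fast ≤ kinetic ≤ periodicEnergy ≤ E₀^per + δ ≤
4πaρ₁N(1 + C a/b) + δ by LSSY2005_upperBound_periodic_holds (in tree), so n_fast ≤ (1+o(1))N/(πM²);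
a = 0 handled by δ < 4π²ηN/L². [difficulty: provable-now] -/
@[route_item "route-AtomisticToContinuum-BECHusimiLaplace"]
def FastFractionBound : Prop :=
  ∀ v : ℝ → ENNReal, Literature.MathematicalPhysics.QuantumManyBody.BoseGas.IsRepulsiveFiniteRange v → ∀ η : ℝ, 0 < η → ∃ M₀ : ℝ, ∀ M : ℝ, M₀ ≤ M → ∃ ρ₀ : ℝ, 0 < ρ₀ ∧ ∀ ρ : ℝ, 0 < ρ → ρ < ρ₀ → ∀ᶠ N : ℕ in Filter.atTop, ∃ δ : ENNReal, 0 < δ ∧ ∀ Ψ : Literature.MathematicalPhysics.QuantumManyBody.BoseGas.PeriodicTrialState N (Literature.MathematicalPhysics.QuantumManyBody.BoseGas.sideLength ρ N), Literature.MathematicalPhysics.QuantumManyBody.BoseGas.periodicEnergy v Ψ ≤ Literature.MathematicalPhysics.QuantumManyBody.BoseGas.periodicGroundStateEnergy v N (Literature.MathematicalPhysics.QuantumManyBody.BoseGas.sideLength ρ N) + δ → let L : ℝ := Literature.MathematicalPhysics.QuantumManyBody.BoseGas.sideLength ρ N; let R : ℕ := ⌊M * L * Real.sqrt (ρ * (Literature.MathematicalPhysics.QuantumManyBody.BoseGas.scatteringLength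 v).toReal)⌋₊; let e : (Fin 3 → Fin (2 * R + 1)) → Literature.MathematicalPhysics.QuantumManyBody.BoseGas.Space → ℂ := fun i x => Literature.MathematicalPhysics.QuantumManyBody.BoseGas.cellWave L (fun k => ((i k : ℕ) : ℤ) - (R : ℤ)) x / (Real.sqrt (L ^ 3) : ℂ); ((N : ENNReal) - ∑ i, Literature.MathematicalPhysics.QuantumManyBody.BoseGas.cellOccupation N L (e i) Ψ.ψ) ≤ ENNReal.ofReal (η * N)

/-- item stmt-AtomisticToContinuum-8200 · support · rank 9 · closed · moot by None · by planner
sources: Rougerie2014, Chiribella2011, LewinNamRougerie2015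
[support] (the Laplace-principle node; = LaplaceCapUnion(PhaseCapDecay, AmplitudeLDP), also
attackable directly) for admissible v and M ≥ 1 there is ρ₀(v,M) such that for ρ < ρ₀, N large, δ
small and every nonnegative periodic near-minimiser: 0 < E_w[|F(u_c)|²] < ∞ and
E_w[|⟨u_c,φ₀⟩|²|F(u_c)|²] ≥ (1 + N/2)·E_w[|F(u_c)|²] — the conditioned state P^(⊗N)Ψ/‖P^(⊗N)Ψ‖ has
constant-mode occupation ≥ N/2. [difficulty: open-problem] -/
@[route_item "route-AtomisticToContinuum-BECHusimiLaplace"]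
def HusimiConcentration : Prop :=
  ∀ v : ℝ → ENNReal, Literature.MathematicalPhysics.QuantumManyBody.BoseGas.IsRepulsiveFiniteRange v → ∀ M : ℝ, 1 ≤ M → ∃ ρ₀ : ℝ, 0 < ρ₀ ∧ ∀ ρ : ℝ, 0 < ρ → ρ < ρ₀ → ∀ᶠ N : ℕ in Filter.atTop, ∃ δ : ENNReal, 0 < δ ∧ ∀ Ψ : Literature.MathematicalPhysics.QuantumManyBody.BoseGas.PeriodicTrialState N (Literature.MathematicalPhysics.QuantumManyBody.BoseGas.sideLength ρ N), Literature.MathematicalPhysics.QuantumManyBody.BoseGas.periodicEnergy v Ψ ≤ Literature.MathematicalPhysics.QuantumManyBody.BoseGas.periodicGroundStateEnergy v N (Literature.MathematicalPhysics.QuantumManyBody.BoseGas.sideLength ρ N) + δ → (∀ X, Ψ.ψ X = ((‖Ψ.ψ X‖ : ℝ) : ℂ)) → let L : ℝ := Literature.MathematicalPhysics.QuantumManyBody.BoseGas.sideLength ρ N; let R : ℕ := ⌊M * L * Real.sqrt (ρ * (Literature.MathematicalPhysics.QuantumManyBody.BoseGas.scatteringLength v).toReal)⌋₊; let e : (Fin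 3 → Fin (2 * R + 1)) → Literature.MathematicalPhysics.QuantumManyBody.BoseGas.Space → ℂ := fun i x => Literature.MathematicalPhysics.QuantumManyBody.BoseGas.cellWave L (fun k => ((i k : ℕ) : ℤ) - (R : ℤ)) x / (Real.sqrt (L ^ 3) : ℂ); let u : ((Fin 3 → Fin (2 * R + 1)) → ℂ) → Literature.MathematicalPhysics.QuantumManyBody.BoseGas.Space → ℂ := fun c x => ∑ i, c i * e i x; let F : (Literature.MathematicalPhysics.QuantumManyBody.BoseGas.Space → ℂ) → ℂ := fun g => ∫ X in Literature.MathematicalPhysics.QuantumManyBody.BoseGas.cellN N L, (∏ j, conj (g (X j))) * Ψ.ψ X; let ov : (Literature.MathematicalPhysics.QuantumManyBody.BoseGas.Space → ℂ) → ℂ := fun g => ∫ x in Literature.MathematicalPhysics.QuantumManyBody.BoseGas.cell L, conj (g x) * Literature.MathematicalPhysics.QuantumManyBody.BoseGas.constantMode L x; let w : ((Fin 3 → Fin (2 * R + 1)) → ℂ) → ENNReal := fun c => ENNReal.ofReal (Real.exp (-(∑ i, ‖c i‖ ^ 2))); (∫⁻ c : (Fin 3 → Fin (2 * R + 1)) →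 ℂ, w c * ((‖F (u c)‖₊ : ENNReal) ^ 2)) ≠ 0 ∧ (∫⁻ c : (Fin 3 → Fin (2 * R + 1)) → ℂ, w c * ((‖F (u c)‖₊ : ENNReal) ^ 2)) ≠ ⊤ ∧ ENNReal.ofReal (1 + (N : ℝ) / 2) * (∫⁻ c : (Fin 3 → Fin (2 * R + 1)) → ℂ, w c * ((‖F (u c)‖₊ : ENNReal) ^ 2)) ≤ (∫⁻ c : (Fin 3 → Fin (2 * R + 1)) → ℂ, w c * ((‖ov (u c)‖₊ : ENNReal) ^ 2) * ((‖F (u c)‖₊ : ENNReal) ^ 2))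

/-- item stmt-AtomisticToContinuum-8201 · support · rank 9 · closed · moot by None · by planner
sources: Rougerie2014, Chiribella2011
[support] PhaseCapDecay → AmplitudeLDP → HusimiConcentration. Bookkeeping of the Laplace principle:
far cap (t := |⟨u,φ₀⟩|²/‖u‖² ≤ ¾) ⊆ rough-phase cap ∪ amplitude-far region; on the latter |F(u_c)| ≤
F(|u_c|) (Ψ ≥ 0) and E_w|F(u_c)|² ≥ E_w[|⟨u_c,φ₀⟩|^(2N)]·|⟨φ₀^(⊗N),Ψ⟩|² (the c̄₀^N coefficient of
the polynomial F(u_c), Gaussian orthogonality of monomials), so the far cap has Husimi mass ≤ ¼;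
then E_w[|⟨u_c,φ₀⟩|²|F|²] ≥ ¾·E_w[1_near ‖u_c‖²|F|²] = ¾(N+d)·E_w[1_near |F|²] ≥ (9/16)(N+d)E_w|F|²
≥ (1+N/2)E_w|F|² for N ≥ 7 (radial integration / Euler identity for the bidegree-(N,N) form;
finiteness and non-vanishing of E_w|F|² from |F(u_c)| ≤ ‖u_c‖^N and ∫Ψ > 0). [glue] [difficulty:
provable-now] -/
@[route_item "route-AtomisticToContinuum-BECHusimiLaplace"]
def LaplaceCapUnion : Prop :=
  PhaseCapDecay → AmplitudeLDP → HusimiConcentration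

/-- item stmt-AtomisticToContinuum-8202 · support · rank 9 · closed · moot by None · by planner
sources: LiebSeiringerSolovejYngvason2005, Fournais2020
[support] constant-mode BEC for NONNEGATIVE periodic near-minimisers: for every admissible v there
is ρ₀ > 0 such that for 0 < ρ < ρ₀ there is c > 0 with: for all large N some δ > 0 makes every
periodic δ-near-minimiser Ψ with Ψ ≥ 0 pointwise satisfy condensateOccupation ≥ cN (the node where
the Husimi cruxes land; = RatioToCondensate(HusimiConcentration, TiltStability, FastFractionBound)
with c = 1/4). [difficulty: open-problem] -/
@[route_item "route-AtomisticToContinuum-BECHusimiLaplace"]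
def PeriodicBECNonneg : Prop :=
  ∀ v : ℝ → ENNReal, Literature.MathematicalPhysics.QuantumManyBody.BoseGas.IsRepulsiveFiniteRange v → ∃ ρ₀ : ℝ, 0 < ρ₀ ∧ ∀ ρ : ℝ, 0 < ρ → ρ < ρ₀ → ∃ c : ℝ, 0 < c ∧ ∀ᶠ N : ℕ in Filter.atTop, ∃ δ : ENNReal, 0 < δ ∧ ∀ Ψ : Literature.MathematicalPhysics.QuantumManyBody.BoseGas.PeriodicTrialState N (Literature.MathematicalPhysics.QuantumManyBody.BoseGas.sideLength ρ N), Literature.MathematicalPhysics.QuantumManyBody.BoseGas.periodicEnergy v Ψ ≤ Literature.MathematicalPhysics.QuantumManyBody.BoseGas.periodicGroundStateEnergy v N (Literature.MathematicalPhysics.QuantumManyBody.BoseGas.sideLength ρ N) + δ → (∀ X, Ψ.ψ X = ((‖Ψ.ψ X‖ : ℝ) : ℂ)) → ENNReal.ofReal (c * N) ≤ Literature.MathematicalPhysics.QuantumManyBody.BoseGas.condensateOccupation N (Literature.MathematicalPhysics.QuantumManyBody.BoseGas.sideLength ρ N) Ψ.ψ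

/-- item stmt-AtomisticToContinuum-8203 · support · rank 9 · closed · moot by None · by planner
sources: LiebSeiringerSolovejYngvason2005
[support] HusimiConcentration → TiltStability → FastFractionBound → PeriodicBECNonneg: with C from
TiltStability take η = 1/(4C), M = max(1, M₀(η)), ρ₀ = min of the three, δ = min of the three; then
(1+N/2)·D ≤ Num ≤ (n₀ + C·ηN + 1)·D with 0 < D < ∞ gives n₀ ≥ N/4 (ENNReal algebra, filter
bookkeeping). [glue] [difficulty: provable-now] -/
@[route_item "route-AtomisticToContinuum-BECHusimiLaplace"]
def RatioToCondensate : Prop :=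
  HusimiConcentration → TiltStability → FastFractionBound → PeriodicBECNonneg

/-- item stmt-AtomisticToContinuum-8204 · support · rank 9 · closed · moot by None · by planner
sources: LiebSeiringerSolovejYngvason2005, PenroseOnsager1956
[support] PeriodicBECNonneg → PeriodicBEC (body of stmt-AtomisticToContinuum-0826 verbatim): at
fixed N and L, as δ → 0 near-minimisers converge in L² (compact resolvent) to the ground space; for
v finite a.e. the periodic ground state is unique and positive (positivity-improving heat kernel,
Reed–Simon XIII.12/47), nonnegative C¹ near-minimisers exist by periodic mollification, and Ψ ↦
⟨φ₀,γ_Ψφ₀⟩ is L²-Lipschitz (|√n₀(Ψ) − √n₀(Φ)| ≤ √N‖Ψ − θΦ‖), so c/2 transfers; hard cores (v = ⊤ on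
[0,a]) need connectedness of the low-density hard-sphere configuration space for uniqueness and
core-respecting approximants — the one caveat. [difficulty: M] -/
@[route_item "route-AtomisticToContinuum-BECHusimiLaplace"]
def PositivityReduction : Prop :=
  PeriodicBECNonneg → ∀ v : ℝ → ENNReal, Literature.MathematicalPhysics.QuantumManyBody.BoseGas.IsRepulsiveFiniteRange v → ∃ ρ₀ : ℝ, 0 < ρ₀ ∧ ∀ ρ : ℝ, 0 < ρ → ρ < ρ₀ → ∃ c : ℝ, 0 < c ∧ ∀ᶠ N : ℕ in Filter.atTop, ∃ δ : ENNReal, 0 < δ ∧ ∀ Ψ : Literature.MathematicalPhysics.QuantumManyBody.BoseGas.PeriodicTrialState N (Literature.MathematicalPhysics.QuantumManyBody.BoseGas.sideLength ρ N), Literature.MathematicalPhysics.QuantumManyBody.BoseGas.periodicEnergy v Ψ ≤ Literature.MathematicalPhysics.QuantumManyBody.BoseGas.periodicGroundStateEnergy v N (Literature.MathematicalPhysics.QuantumManyBody.BoseGas.sideLength ρ N) + δ → ENNReal.ofReal (c * N) ≤ Literature.MathematicalPhysics.QuantumManyBody.BoseGas.condensateOccupation N (Literature.MathematicalPhysics.QuantumManyBody.BoseGas.sideLength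 ρ N) Ψ.ψ

-- TODO item stmt-AtomisticToContinuum-8205 · assembly · rank 1 · closed · moot by None · by planner — BLOCKED: missing decl(s) BoundaryTransferWeak; restate via `ledger route edit` once they land:
--   def Assembly : Prop := PhaseCapDecay → AmplitudeLDP → TiltStability → LaplaceCapUnion → FastFractionBound → RatioToCondensate → PositivityReduction → BoundaryTransferWeak → Literature.MathematicalPhysics.QuantumManyBody.BoseGas.BoseEinsteinCondensation

end Summit.AtomisticToContinuum.BoseEinsteinCondensation.Theses.BECHusimiLaplace
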